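import Literature.Analysis.FluidPDE.LerayProfileCalculus
import Literature.Analysis.FluidPDE.NewtonPotential
import Literature.Analysis.FluidPDE.MildSolutionProofs
import Literature.Analysis.FluidPDE.WeightedVelocityBounds
import HarnessLib

/-!
# Tsai's local gradient estimate (Lemma 3.1, (3.1)) for smooth Leray profiles

Analysis/FluidPDE proofs layer for the decomposition of the named fact
`Literature.Analysis.FluidPDE.tsai1998_lemma32` (`FluidPDE/TsaiGrowthLemmas`; T.-P. Tsai, *On
Leray's self-similar solutions of the Navier–Stokes equations satisfying local energy
estimates*, Arch. Rational Mech. Anal. 143 (1998) 29–51, **Lemma 3.2**).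

Tsai's **Lemma 3.1** (p. 36) and its proof (p. 37): for a smooth solution `(U, P)` of Leray's
system (1.3), `−νΔU + aU + a(y·∇)U + (U·∇)U + ∇P = 0`, `div U = 0`, "we take the dot product of
(1.3) with `φU` and then integrate. Since `U` is smooth and `−U·ΔU = |∇U|² − ½Δ|U|²`, we get
`∫ νφ|∇U|² = ½ν∫U²Δφ − a∫U²φ + ½∫U²(ay + U)·∇φ + (3/2)a∫U²φ + ∫ P U·∇φ`. Hence
(3.1) `∫_{B₁} ν|∇U|² ≤ C ∫_{B₂} [U² + |y₀|U² + |U|³ + |PU|]`."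

This file proves exactly this, for the tree's profile class `IsLerayProfile ν a U P` with
`U ∈ C^∞` (as in print, where weak solutions are smooth by p. 33; the named fact
`tsai1998_profile_smooth` of `TsaiGrowthLemmas`), any test function `φ ∈ C²_c((EuclideanSpace ℝ (Fin 3)))`, and with `P`
replaced by `P − c` for an arbitrary constant `c` (the pressure enters (1.3) only through `∇P`;
equivalently `∫ c U·∇φ = −c ∫ φ div U = 0`):

* `IsLerayProfile.integral_mul_frobeniusNormSq_fderiv_eq` — **the energy identity**
  `ν ∫ φ |DU|² = (ν/2) ∫ Δφ |U|² + (a/2) ∫ φ |U|² + (a/2) ∫ Dφ(y)[y] |U|² + ½ ∫ Dφ(y)[U] |U|²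
   + ∫ (P − c) ⟪U, ∇φ⟫`
  (`|DU|²` the Frobenius norm `frobeniusNormSq`; all integrals over `(EuclideanSpace ℝ (Fin 3))`), from
  `Δ|U|² = 2⟪ΔU, U⟫ + 2|DU|²` (`LerayProfileCalculus`), Green's second identity, the trilinear
  convection identity of `WholeSpaceIBP` (with the vector fields `y ↦ y`, of divergence `3`, and
  `U`, of divergence `0`) and `∫ ⟪∇P, φU⟫ = −∫ P div(φU) = −∫ P ⟪U, ∇φ⟫`;
* `IsLerayProfile.integral_ball_frobeniusNormSq_fderiv_le` — **(3.1) on balls `B(x₀, R)`**: with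
  the cutoff `φ = χ_R(· − x₀)` (`= 1` on `B(x₀, R)`, supported in `B̄(x₀, 2R)`, `‖Dφ‖ ≤ C₁/R`,
  `|Δφ| ≤ C₂/R²`),
  `ν ∫_{B(x₀,R)} |DU|² ≤ (νC₂/(2R²) + a/2 + aC₁(|x₀| + 2R)/(2R)) ∫_{B̄(x₀,2R)} |U|²
    + (C₁/(2R)) ∫_{B̄(x₀,2R)} |U|³ + (C₁/R) ∫_{B̄(x₀,2R)} |P − c| |U|`,
  which is Tsai's (3.1) with the constants and the factor `|y₀|` (from the drift `a(y·∇)U`)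
  explicit.

The `o(|y₀|^{1/2})`/`O(|y₀|^{1/2})` conclusion of Lemma 3.1 for `‖∇U‖_{2,B₁(y₀)}` follows by
inserting `U ∈ L^q`, `q ≥ 3`, and the local pressure control of `FluidPDE/TsaiLocalPressure`
into the right-hand side; this is done where the bootstrap consumes it
(`FluidPDE/TsaiPressureGrowth`). Everything here is proved; no definitions, no named facts.

## References

* T.-P. Tsai, *On Leray's self-similar solutions of the Navier–Stokes equations satisfying local
  energy estimates*, Arch. Rational Mech. Anal. 143 (1998), Lemma 3.1 and its proof, display
  (3.1), Remark 3.1 (pp. 36–37) [Tsai1998].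
* J. Leray, *Sur le mouvement d'un liquide visqueux emplissant l'espace*, Acta Math. 63 (1934),
  §6 (1.11), §17 (3.4) (integration by parts without boundary) [Leray1934].
-/

noncomputable section

open MeasureTheory Set Function Filter Topology InnerProductSpace Metric
open scoped RealInnerProductSpace Laplacian ContDiff ENNReal NNReal

namespace Literature.Analysis.FluidPDE

section GradientEstimate

variable {ν a : ℝ} {U : (EuclideanSpace ℝ (Fin 3)) → (EuclideanSpace ℝ (Fin 3))} {P : (EuclideanSpace ℝ (Fin 3)) → ℝ}

/-! ### Integrability bookkeeping: continuous integrands against a compactly supported factor -/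

/-- `φ G` is integrable for `φ` continuous with compact support and `G` continuous. [folklore] -/
theorem integrable_mul_of_hasCompactSupport_left {φ G : (EuclideanSpace ℝ (Fin 3)) → ℝ} (hφ : Continuous φ)
    (hφc : HasCompactSupport φ) (hG : Continuous G) : Integrable fun x => φ x * G x :=
  (hφ.mul hG).integrable_of_hasCompactSupport hφc.mul_right

/-! ### The five identities behind Lemma 3.1 -/

/-- **`∫ φ |DU|² = ½ ∫ Δφ |U|² − ∫ φ ⟪ΔU, U⟫`** for `U ∈ C²`, `φ ∈ C²_c` (`Δ|U|² = 2⟪ΔU,U⟫ + 2|DU|²`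
and Green's second identity `∫ φ Δ|U|² = ∫ Δφ |U|²`; Tsai: "`−U·ΔU = |∇U|² − ½Δ|U|²`").
[cite: Tsai1998, proof of Lemma 3.1 (p. 37)] -/
theorem integral_mul_frobeniusNormSq_fderiv_eq_of_contDiff (hU : ContDiff ℝ 2 U) {φ : (EuclideanSpace ℝ (Fin 3)) → ℝ}
    (hφ : ContDiff ℝ 2 φ) (hφc : HasCompactSupport φ) :
    ∫ x, φ x * frobeniusNormSq (fderiv ℝ U x) =
      (1 / 2) * (∫ x, (Δ φ) x * ‖U x‖ ^ 2) - ∫ x, φ x * ⟪(Δ U) x, U x⟫ := by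
  have hU1 : ContDiff ℝ 1 U := hU.of_le one_le_two
  have hsq : ContDiff ℝ 2 fun y => ⟪U y, U y⟫ := hU.inner ℝ hU
  -- Green: `∫ φ Δ|U|² = ∫ Δφ |U|²`
  have hnorm : ∀ y, ⟪U y, U y⟫ = ‖U y‖ ^ 2 := fun y => real_inner_self_eq_norm_sq _
  have green : ∫ x, φ x * (Δ fun y => ⟪U y, U y⟫) x = ∫ x, (Δ φ) x * ‖U x‖ ^ 2 := by
    rw [integral_mul_laplacian_comm hsq hφ hφc]
    exact integral_congr_ae (Eventually.of_forall fun x => by simp only [hnorm])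
  -- pointwise `φ Δ|U|² = 2 φ ⟪ΔU,U⟫ + 2 φ |DU|²`
  have hpt : ∀ x, φ x * (Δ fun y => ⟪U y, U y⟫) x =
      2 * (φ x * ⟪(Δ U) x, U x⟫) + 2 * (φ x * frobeniusNormSq (fderiv ℝ U x)) := fun x => by
    rw [laplacian_inner_self_eq hU x]; ring
  have h1 : Integrable fun x => φ x * ⟪(Δ U) x, U x⟫ :=
    integrable_mul_of_hasCompactSupport_left hφ.continuous hφc
      ((FluidPDE.continuous_laplacian hU).inner hU.continuous)
  have h2 : Integrable fun x => φ x * frobeniusNormSq (fderiv ℝ U x) :=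
    integrable_mul_of_hasCompactSupport_left hφ.continuous hφc
      (continuous_frobeniusNormSq_fderiv hU two_ne_zero)
  have hsum : ∫ x, φ x * (Δ fun y => ⟪U y, U y⟫) x =
      2 * (∫ x, φ x * ⟪(Δ U) x, U x⟫) + 2 * ∫ x, φ x * frobeniusNormSq (fderiv ℝ U x) := by
    simp_rw [hpt]
    rw [integral_add (h1.const_mul 2) (h2.const_mul 2), integral_const_mul, integral_const_mul]
  rw [hsum] at green
  linarith

/-- **`∫ φ ⟪DU(y) y, U(y)⟫ dy = −½ ∫ Dφ(y)[y] |U|² − (3/2) ∫ φ |U|²`** for `U ∈ C¹`, `φ ∈ C¹_c`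
(the trilinear identity with the field `y ↦ y`, of divergence `3`; Tsai's term
`½∫U² ay·∇φ + (3/2)a∫U²φ`). [cite: Tsai1998, proof of Lemma 3.1 (p. 37)] -/
theorem integral_mul_inner_fderiv_apply_self_eq (hU : ContDiff ℝ 1 U) {φ : (EuclideanSpace ℝ (Fin 3)) → ℝ}
    (hφ : ContDiff ℝ 1 φ) (hφc : HasCompactSupport φ) :
    ∫ x, φ x * ⟪fderiv ℝ U x x, U x⟫ =
      -(1 / 2) * (∫ x, fderiv ℝ φ x x * ‖U x‖ ^ 2) - (3 / 2) * ∫ x, φ x * ‖U x‖ ^ 2 := by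
  have hW : ContDiff ℝ 1 fun x => φ x • U x := hφ.smul hU
  have hWc : HasCompactSupport fun x => φ x • U x := hφc.smul_right
  have key := integral_inner_convect_add_eq_zero (u := fun x : (EuclideanSpace ℝ (Fin 3)) => x) (v := U)
    (w := fun x => φ x • U x) contDiff_id hU hW hWc
  have hφd : Differentiable ℝ φ := hφ.differentiable one_ne_zero
  have hUd : Differentiable ℝ U := hU.differentiable one_ne_zero
  have h1 : ∀ x, ⟪convect (fun x : (EuclideanSpace ℝ (Fin 3)) => x) U x, φ x • U x⟫ = φ x * ⟪fderiv ℝ U x x, U x⟫ :=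
    fun x => by rw [convect_apply, inner_smul_right]
  have h2 : ∀ x, ⟪U x, convect (fun x : (EuclideanSpace ℝ (Fin 3)) => x) (fun x => φ x • U x) x⟫ =
      fderiv ℝ φ x x * ‖U x‖ ^ 2 + φ x * ⟪fderiv ℝ U x x, U x⟫ := fun x => by
    rw [convect_apply, fderiv_fun_smul (hφd x) (hUd x)]
    simp only [_root_.add_apply, _root_.FunLike.coe_smul, Pi.smul_apply,
      ContinuousLinearMap.smulRight_apply, inner_add_right, inner_smul_right,
      real_inner_self_eq_norm_sq, real_inner_comm (U x)]
    ring
  have h3 : ∀ x, VectorCalculus.divergence (fun x : (EuclideanSpace ℝ (Fin 3)) => x) x * ⟪U x, φ x • U x⟫ =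
      3 * (φ x * ‖U x‖ ^ 2) := fun x => by
    rw [divergence_id_eq_finrank, finrank_euclideanSpace_fin, inner_smul_right,
      real_inner_self_eq_norm_sq]
    push_cast; ring
  simp_rw [h1, h2, h3] at key
  have iA : Integrable fun x => φ x * ⟪fderiv ℝ U x x, U x⟫ :=
    integrable_mul_of_hasCompactSupport_left hφ.continuous hφc
      (((hU.continuous_fderiv one_ne_zero).clm_apply continuous_id).inner hU.continuous)
  have iB : Integrable fun x => fderiv ℝ φ x x * ‖U x‖ ^ 2 :=
    (((hφ.continuous_fderiv one_ne_zero).clm_apply continuous_id).mul (hU.continuous.norm.pow 2))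
      |>.integrable_of_hasCompactSupport ((hφc.fderiv (𝕜 := ℝ)).mono fun x hx => by
        contrapose! hx; simp only [mem_support, not_not] at hx; simp [hx])
  have iC : Integrable fun x => φ x * ‖U x‖ ^ 2 :=
    integrable_mul_of_hasCompactSupport_left hφ.continuous hφc (hU.continuous.norm.pow 2)
  rw [integral_add iB iA, integral_const_mul] at key
  linarith

/-- **`∫ φ ⟪(U·∇)U, U⟫ = −½ ∫ Dφ(y)[U(y)] |U|²`** for a divergence-free `U ∈ C¹` and `φ ∈ C¹_c`
(the trilinear identity; Tsai's term `½∫U² U·∇φ`). [cite: Tsai1998, proof of Lemma 3.1 (p. 37)] -/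
theorem integral_mul_inner_convect_self_eq (hU : ContDiff ℝ 1 U) (hdiv : VectorCalculus.IsDivFree U)
    {φ : (EuclideanSpace ℝ (Fin 3)) → ℝ} (hφ : ContDiff ℝ 1 φ) (hφc : HasCompactSupport φ) :
    ∫ x, φ x * ⟪convect U U x, U x⟫ = -(1 / 2) * ∫ x, fderiv ℝ φ x (U x) * ‖U x‖ ^ 2 := by
  have hW : ContDiff ℝ 1 fun x => φ x • U x := hφ.smul hU
  have hWc : HasCompactSupport fun x => φ x • U x := hφc.smul_right
  have key := integral_inner_convect_add_eq_zero (u := U) (v := U) (w := fun x => φ x • U x)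
    hU hU hW hWc
  have hφd : Differentiable ℝ φ := hφ.differentiable one_ne_zero
  have hUd : Differentiable ℝ U := hU.differentiable one_ne_zero
  have h1 : ∀ x, ⟪convect U U x, φ x • U x⟫ = φ x * ⟪convect U U x, U x⟫ :=
    fun x => by rw [inner_smul_right]
  have h2 : ∀ x, ⟪U x, convect U (fun x => φ x • U x) x⟫ =
      fderiv ℝ φ x (U x) * ‖U x‖ ^ 2 + φ x * ⟪convect U U x, U x⟫ := fun x => by
    rw [convect_apply, fderiv_fun_smul (hφd x) (hUd x)]
    simp only [_root_.add_apply, _root_.FunLike.coe_smul, Pi.smul_apply,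
      ContinuousLinearMap.smulRight_apply, inner_add_right, inner_smul_right,
      real_inner_self_eq_norm_sq, convect_apply, real_inner_comm (U x)]
    ring
  have h3 : ∀ x, VectorCalculus.divergence U x * ⟪U x, φ x • U x⟫ = 0 := fun x => by
    rw [hdiv x, zero_mul]
  simp_rw [h1, h2, h3] at key
  rw [integral_zero, add_zero] at key
  have iA : Integrable fun x => φ x * ⟪convect U U x, U x⟫ :=
    integrable_mul_of_hasCompactSupport_left hφ.continuous hφc
      (((hU.continuous_fderiv one_ne_zero).clm_apply hU.continuous).inner hU.continuous)
  have iB : Integrable fun x => fderiv ℝ φ x (U x) * ‖U x‖ ^ 2 :=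
    (((hφ.continuous_fderiv one_ne_zero).clm_apply hU.continuous).mul (hU.continuous.norm.pow 2))
      |>.integrable_of_hasCompactSupport ((hφc.fderiv (𝕜 := ℝ)).mono fun x hx => by
        contrapose! hx; simp only [mem_support, not_not] at hx; simp [hx])
  rw [integral_add iB iA] at key
  linarith

/-- **`∫ φ ⟪∇P, U⟫ = −∫ (P − c) ⟪U, ∇φ⟫`** for `P ∈ C¹`, a divergence-free `U ∈ C¹`, `φ ∈ C¹_c` and
any constant `c` (`∫ ⟪∇(P − c), φU⟫ = −∫ (P − c) div(φU)`, `div(φU) = ⟪U, ∇φ⟫`).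
[cite: Tsai1998, proof of Lemma 3.1 (p. 37)] -/
theorem integral_mul_inner_gradient_eq (hP : ContDiff ℝ 1 P) (hU : ContDiff ℝ 1 U)
    (hdiv : VectorCalculus.IsDivFree U) {φ : (EuclideanSpace ℝ (Fin 3)) → ℝ} (hφ : ContDiff ℝ 1 φ)
    (hφc : HasCompactSupport φ) (c : ℝ) :
    ∫ x, φ x * ⟪gradient P x, U x⟫ = -∫ x, (P x - c) * ⟪U x, gradient φ x⟫ := by
  have hPc : ContDiff ℝ 1 fun x => P x - c := hP.sub contDiff_const
  have hW : ContDiff ℝ 1 fun x => φ x • U x := hφ.smul hU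
  have hWc : HasCompactSupport fun x => φ x • U x := hφc.smul_right
  have key := integral_inner_gradient_eq_neg_integral_mul_divergence hPc hW hWc
  have hgrad : ∀ x, gradient (fun x => P x - c) x = gradient P x := fun x => by
    simp only [gradient, fderiv_sub_const]
  have hφd : Differentiable ℝ φ := hφ.differentiable one_ne_zero
  have hUd : Differentiable ℝ U := hU.differentiable one_ne_zero
  have h1 : ∀ x, ⟪gradient (fun x => P x - c) x, φ x • U x⟫ = φ x * ⟪gradient P x, U x⟫ :=
    fun x => by rw [hgrad, inner_smul_right]
  have h2 : ∀ x, (P x - c) * VectorCalculus.divergence (fun y => φ y • U y) x =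
      (P x - c) * ⟪U x, gradient φ x⟫ := fun x => by
    rw [divergence_smul_apply (hφd x) (hUd x), hdiv x, mul_zero, zero_add]
  simp_rw [h1, h2] at key
  exact key

/-! ### The energy identity and Tsai's (3.1) -/

/-- **Energy identity for Leray profiles tested against `φU`** (Tsai 1998, proof of Lemma 3.1):
for a Leray profile `(U, P)` with `U ∈ C^∞`, a test function `φ ∈ C²_c` and any constant `c`,
`ν ∫ φ |DU|² = (ν/2) ∫ Δφ |U|² + (a/2) ∫ φ |U|² + (a/2) ∫ Dφ(y)[y] |U|² + ½ ∫ Dφ(y)[U] |U|²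
  + ∫ (P − c) ⟪U, ∇φ⟫`. [cite: Tsai1998, proof of Lemma 3.1 (p. 37)] -/
theorem IsLerayProfile.integral_mul_frobeniusNormSq_fderiv_eq (hprof : IsLerayProfile ν a U P)
    (hU : ContDiff ℝ ∞ U) {φ : (EuclideanSpace ℝ (Fin 3)) → ℝ} (hφ : ContDiff ℝ 2 φ) (hφc : HasCompactSupport φ) (c : ℝ) :
    ν * ∫ x, φ x * frobeniusNormSq (fderiv ℝ U x) =
      (ν / 2) * (∫ x, (Δ φ) x * ‖U x‖ ^ 2) + (a / 2) * (∫ x, φ x * ‖U x‖ ^ 2)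
      + (a / 2) * (∫ x, fderiv ℝ φ x x * ‖U x‖ ^ 2)
      + (1 / 2) * (∫ x, fderiv ℝ φ x (U x) * ‖U x‖ ^ 2)
      + ∫ x, (P x - c) * ⟪U x, gradient φ x⟫ := by
  have hU3 : ContDiff ℝ 3 U := hU.of_le (by norm_cast)
  have hU2 : ContDiff ℝ 2 U := hU.of_le (by norm_cast)
  have hU1 : ContDiff ℝ 1 U := hU.of_le (by norm_cast)
  have hP1 : ContDiff ℝ 1 P := (hprof.contDiff_two_pressure hU3).of_le one_le_two
  have hφ1 : ContDiff ℝ 1 φ := hφ.of_le one_le_two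
  -- the system, paired with `φU`: `ν φ⟪ΔU,U⟫ = a φ|U|² + a φ⟪DU y y, U⟫ + φ⟪(U·∇)U, U⟫ + φ⟪∇P, U⟫`
  have hsys : ∀ x, ν * (φ x * ⟪(Δ U) x, U x⟫) = a * (φ x * ‖U x‖ ^ 2)
      + a * (φ x * ⟪fderiv ℝ U x x, U x⟫) + φ x * ⟪convect U U x, U x⟫
      + φ x * ⟪gradient P x, U x⟫ := fun x => by
    have hx := hprof.profile_eq x
    have hΔ : ν • (Δ U) x = a • U x + a • fderiv ℝ U x x + convect U U x + gradient P x := by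
      rw [← sub_eq_zero, ← neg_eq_zero, ← hx]; abel
    have := congrArg (fun v => φ x * ⟪v, U x⟫) hΔ
    simp only [inner_smul_left, inner_add_left, RCLike.conj_to_real, real_inner_self_eq_norm_sq] at this
    linarith
  have iLap : Integrable fun x => φ x * ⟪(Δ U) x, U x⟫ :=
    integrable_mul_of_hasCompactSupport_left hφ.continuous hφc
      ((FluidPDE.continuous_laplacian hU2).inner hU.continuous)
  have iSq : Integrable fun x => φ x * ‖U x‖ ^ 2 :=
    integrable_mul_of_hasCompactSupport_left hφ.continuous hφc (hU.continuous.norm.pow 2)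
  have iDr : Integrable fun x => φ x * ⟪fderiv ℝ U x x, U x⟫ :=
    integrable_mul_of_hasCompactSupport_left hφ.continuous hφc
      (((hU1.continuous_fderiv one_ne_zero).clm_apply continuous_id).inner hU.continuous)
  have iCv : Integrable fun x => φ x * ⟪convect U U x, U x⟫ :=
    integrable_mul_of_hasCompactSupport_left hφ.continuous hφc
      (((hU1.continuous_fderiv one_ne_zero).clm_apply hU.continuous).inner hU.continuous)
  have iPr : Integrable fun x => φ x * ⟪gradient P x, U x⟫ :=
    integrable_mul_of_hasCompactSupport_left hφ.continuous hφc
      ((continuous_gradient_of_contDiff hP1).inner hU.continuous)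
  have hint : ν * (∫ x, φ x * ⟪(Δ U) x, U x⟫) = a * (∫ x, φ x * ‖U x‖ ^ 2)
      + a * (∫ x, φ x * ⟪fderiv ℝ U x x, U x⟫) + (∫ x, φ x * ⟪convect U U x, U x⟫)
      + ∫ x, φ x * ⟪gradient P x, U x⟫ := by
    rw [← integral_const_mul, ← integral_const_mul, ← integral_const_mul]
    rw [← integral_add, ← integral_add, ← integral_add]
    · exact integral_congr_ae (Eventually.of_forall hsys)
    · exact ((iSq.const_mul a).add (iDr.const_mul a)).add iCv
    · exact iPr
    · exact (iSq.const_mul a).add (iDr.const_mul a)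
    · exact iCv
    · exact iSq.const_mul a
    · exact iDr.const_mul a
  have e1 := integral_mul_frobeniusNormSq_fderiv_eq_of_contDiff hU2 hφ hφc
  have e2 := integral_mul_inner_fderiv_apply_self_eq hU1 hφ1 hφc
  have e3 := integral_mul_inner_convect_self_eq hU1 hprof.divFree hφ1 hφc
  have e4 := integral_mul_inner_gradient_eq hP1 hU1 hprof.divFree hφ1 hφc c
  rw [e2, e3, e4] at hint
  rw [e1]
  linear_combination -hint

/-! ### Tsai's (3.1) on balls -/

/-- The translated cutoff `φ = χ_R(· − x₀)`: smooth, compactly supported in `B̄(x₀, 2R)`, values in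
`[0, 1]`, `= 1` on `B̄(x₀, R)`, with `‖Dφ‖ ≤ C₁/R`, `|Δφ| ≤ C₂/R²` for the universal constants of
`exists_norm_fderiv_cutoff_le`, `exists_abs_laplacian_cutoff_le`. [folklore] -/
theorem cutoff_sub_props {C₁ C₂ : ℝ} (hC₁ : ∀ R : ℝ, 0 < R → ∀ x : (EuclideanSpace ℝ (Fin 3)), ‖fderiv ℝ (cutoff R) x‖ ≤ C₁ / R)
    (hC₂ : ∀ R : ℝ, 0 < R → ∀ x : (EuclideanSpace ℝ (Fin 3)), |(Δ (cutoff R : (EuclideanSpace ℝ (Fin 3)) → ℝ)) x| ≤ C₂ / R ^ 2) {R : ℝ} (hR : 0 < R)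
    (x₀ : (EuclideanSpace ℝ (Fin 3))) :
    ContDiff ℝ 2 (fun x : (EuclideanSpace ℝ (Fin 3)) => cutoff R (x - x₀)) ∧
    HasCompactSupport (fun x : (EuclideanSpace ℝ (Fin 3)) => cutoff R (x - x₀)) ∧
    tsupport (fun x : (EuclideanSpace ℝ (Fin 3)) => cutoff R (x - x₀)) ⊆ closedBall x₀ (2 * R) ∧
    (∀ x, 0 ≤ cutoff R (x - x₀) ∧ cutoff R (x - x₀) ≤ 1) ∧
    (∀ x ∈ closedBall x₀ R, cutoff R (x - x₀) = 1) ∧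
    (∀ x, ‖fderiv ℝ (fun x : (EuclideanSpace ℝ (Fin 3)) => cutoff R (x - x₀)) x‖ ≤ C₁ / R) ∧
    (∀ x, |(Δ (fun x : (EuclideanSpace ℝ (Fin 3)) => cutoff R (x - x₀))) x| ≤ C₂ / R ^ 2) := by
  have hsupp : tsupport (fun x : (EuclideanSpace ℝ (Fin 3)) => cutoff R (x - x₀)) ⊆ closedBall x₀ (2 * R) := by
    refine closure_minimal (fun x hx => ?_) isClosed_closedBall
    rw [mem_closedBall, dist_eq_norm]
    by_contra hgt
    exact hx (cutoff_eq_zero hR (not_le.1 hgt).le)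
  refine ⟨(contDiff_cutoff (n := 2) R).comp (contDiff_id.sub contDiff_const), ?_, hsupp,
    fun x => ⟨cutoff_nonneg _ _, cutoff_le_one _ _⟩, fun x hx => ?_, fun x => ?_, fun x => ?_⟩
  · exact (isCompact_closedBall x₀ (2 * R)).of_isClosed_subset isClosed_closure hsupp
  · exact cutoff_eq_one hR (by rwa [mem_closedBall, dist_eq_norm] at hx)
  · rw [fderiv_comp_sub]; exact hC₁ R hR _
  · have h1 : (fun x : (EuclideanSpace ℝ (Fin 3)) => cutoff R (x - x₀)) = fun x => cutoff R (-x₀ + x) := by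
      funext x; rw [neg_add_eq_sub]
    rw [h1, laplacian_comp_const_add]
    exact hC₂ R hR _

/-- **Tsai's gradient estimate (3.1) on balls, with explicit constants.** There are universal
constants `C₁, C₂ ≥ 0` such that for every Leray profile `(U, P)` on `(EuclideanSpace ℝ (Fin 3))` with `U ∈ C^∞`,
`ν, a ≥ 0`, every ball `B(x₀, R)`, `R > 0`, and every constant `c`:
`ν ∫_{B(x₀,R)} |DU|² ≤ (νC₂/(2R²) + a/2 + aC₁(|x₀| + 2R)/(2R)) ∫_{B̄(x₀,2R)} |U|²
  + (C₁/(2R)) ∫_{B̄(x₀,2R)} |U|³ + (C₁/R) ∫_{B̄(x₀,2R)} |P − c| |U|`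
(`|DU|²` the Frobenius norm). This is display (3.1) of Tsai 1998,
`∫_{B₁} ν|∇U|² ≤ C ∫_{B₂} [U² + |y₀|U² + |U|³ + |PU|]`, with the radius, the constants and the origin
of the factor `|y₀|` (the drift term `a(y·∇)U`, through `½∫U² ay·∇φ`) made explicit, and `P`
normalised by an arbitrary constant. [cite: Tsai1998, Lemma 3.1, (3.1) (p. 37)] -/
theorem IsLerayProfile.exists_gradient_estimate_consts :
    ∃ C₁ C₂ : ℝ, 0 ≤ C₁ ∧ 0 ≤ C₂ ∧ ∀ {ν a : ℝ} {U : (EuclideanSpace ℝ (Fin 3)) → (EuclideanSpace ℝ (Fin 3))} {P : (EuclideanSpace ℝ (Fin 3)) → ℝ},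
      IsLerayProfile ν a U P → ContDiff ℝ ∞ U → 0 ≤ ν → 0 ≤ a →
      ∀ {R : ℝ}, 0 < R → ∀ (x₀ : (EuclideanSpace ℝ (Fin 3))) (c : ℝ),
        ν * ∫ x in ball x₀ R, frobeniusNormSq (fderiv ℝ U x) ≤
          (ν * C₂ / (2 * R ^ 2) + a / 2 + a * C₁ * (‖x₀‖ + 2 * R) / (2 * R)) *
              (∫ x in closedBall x₀ (2 * R), ‖U x‖ ^ 2)
            + C₁ / (2 * R) * (∫ x in closedBall x₀ (2 * R), ‖U x‖ ^ 3)
            + C₁ / R * ∫ x in closedBall x₀ (2 * R), |P x - c| * ‖U x‖ := by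
  obtain ⟨C₁, hC₁0, hC₁⟩ := exists_norm_fderiv_cutoff_le (E := (EuclideanSpace ℝ (Fin 3)))
  obtain ⟨C₂, hC₂0, hC₂⟩ := exists_abs_laplacian_cutoff_le (E := (EuclideanSpace ℝ (Fin 3)))
  refine ⟨C₁, C₂, hC₁0, hC₂0, fun {ν a U P} hprof hU hν ha {R} hR x₀ c => ?_⟩
  obtain ⟨hφ2, hφc, hφS, hφ01, hφ1, hDφ, hΔφ⟩ := cutoff_sub_props hC₁ hC₂ hR x₀
  set φ : (EuclideanSpace ℝ (Fin 3)) → ℝ := fun x => cutoff R (x - x₀) with hφd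
  have hUc : Continuous U := hU.continuous
  have hU2 : ContDiff ℝ 2 U := hU.of_le (by norm_cast)
  set S := closedBall x₀ (2 * R) with hSd
  have hS : MeasurableSet S := measurableSet_closedBall
  have hSc : IsCompact S := isCompact_closedBall _ _
  have hSR : ∀ x ∈ S, ‖x‖ ≤ ‖x₀‖ + 2 * R := fun x hx => by
    rw [hSd, mem_closedBall, dist_eq_norm] at hx
    calc ‖x‖ = ‖(x - x₀) + x₀‖ := by rw [sub_add_cancel]
      _ ≤ ‖x - x₀‖ + ‖x₀‖ := norm_add_le _ _
      _ ≤ 2 * R + ‖x₀‖ := by gcongr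
      _ = ‖x₀‖ + 2 * R := add_comm _ _
  -- the identity
  have hid := hprof.integral_mul_frobeniusNormSq_fderiv_eq hU hφ2 hφc c
  -- vanishing of `φ`, `Dφ`, `Δφ` off `S`
  have hφ0 : ∀ x ∉ S, φ x = 0 := fun x hx => image_eq_zero_of_notMem_tsupport fun h => hx (hφS h)
  have hDφ0 : ∀ x ∉ S, fderiv ℝ φ x = 0 := fun x hx => fderiv_of_notMem_tsupport ℝ fun h => hx (hφS h)
  have hΔφ0 : ∀ x ∉ S, (Δ φ) x = 0 := fun x hx => laplacian_eq_zero_of_notMem_tsupport fun h => hx (hφS h)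
  -- local integrals of `U`
  have hI2 : IntegrableOn (fun x => ‖U x‖ ^ 2) S := (hUc.norm.pow 2).continuousOn.integrableOn_compact hSc
  have hI3 : IntegrableOn (fun x => ‖U x‖ ^ 3) S := (hUc.norm.pow 3).continuousOn.integrableOn_compact hSc
  have hP1 : ContDiff ℝ 1 P := (hprof.contDiff_two_pressure (hU.of_le (by norm_cast))).of_le one_le_two
  have hIP : IntegrableOn (fun x => |P x - c| * ‖U x‖) S :=
    (((hP1.continuous.sub continuous_const).abs).mul hUc.norm).continuousOn.integrableOn_compact hSc
  set J₂ := ∫ x in S, ‖U x‖ ^ 2 with hJ₂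
  set J₃ := ∫ x in S, ‖U x‖ ^ 3 with hJ₃
  set JP := ∫ x in S, |P x - c| * ‖U x‖ with hJP
  have hJ₂0 : 0 ≤ J₂ := integral_nonneg fun x => by positivity
  have hJ₃0 : 0 ≤ J₃ := integral_nonneg fun x => by positivity
  have hJP0 : 0 ≤ JP := integral_nonneg fun x => by positivity
  have hC₁R : 0 ≤ C₁ / R := div_nonneg hC₁0 hR.le
  -- term bounds
  have t1 : |∫ x, (Δ φ) x * ‖U x‖ ^ 2| ≤ C₂ / R ^ 2 * J₂ := by
    refine abs_integral_le_of_support_subset hS (fun x hx => by rw [hΔφ0 x hx, zero_mul])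
      (fun x _ => ?_) hI2
    rw [abs_mul, abs_pow, abs_norm]
    exact mul_le_mul_of_nonneg_right (hΔφ x) (by positivity)
  have t2 : |∫ x, φ x * ‖U x‖ ^ 2| ≤ 1 * J₂ := by
    refine abs_integral_le_of_support_subset hS (fun x hx => by rw [hφ0 x hx, zero_mul])
      (fun x _ => ?_) hI2
    rw [abs_mul, abs_pow, abs_norm, abs_of_nonneg (hφ01 x).1]
    exact mul_le_mul_of_nonneg_right (hφ01 x).2 (by positivity)
  have t3 : |∫ x, fderiv ℝ φ x x * ‖U x‖ ^ 2| ≤ C₁ / R * (‖x₀‖ + 2 * R) * J₂ := by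
    refine abs_integral_le_of_support_subset hS
      (fun x hx => by rw [hDφ0 x hx, _root_.zero_apply, zero_mul]) (fun x hx => ?_) hI2
    rw [abs_mul, abs_pow, abs_norm]
    refine mul_le_mul_of_nonneg_right ?_ (by positivity)
    rw [← Real.norm_eq_abs]
    calc ‖fderiv ℝ φ x x‖ ≤ ‖fderiv ℝ φ x‖ * ‖x‖ := ContinuousLinearMap.le_opNorm _ _
      _ ≤ C₁ / R * (‖x₀‖ + 2 * R) := mul_le_mul (hDφ x) (hSR x hx) (norm_nonneg _) hC₁R
  have t4 : |∫ x, fderiv ℝ φ x (U x) * ‖U x‖ ^ 2| ≤ C₁ / R * J₃ := by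
    refine abs_integral_le_of_support_subset hS
      (fun x hx => by rw [hDφ0 x hx, _root_.zero_apply, zero_mul]) (fun x _ => ?_) hI3
    rw [abs_mul, abs_pow, abs_norm]
    have hD : |fderiv ℝ φ x (U x)| ≤ C₁ / R * ‖U x‖ := by
      rw [← Real.norm_eq_abs]
      calc ‖fderiv ℝ φ x (U x)‖ ≤ ‖fderiv ℝ φ x‖ * ‖U x‖ := ContinuousLinearMap.le_opNorm _ _
        _ ≤ C₁ / R * ‖U x‖ := by gcongr; exact hDφ x
    calc |fderiv ℝ φ x (U x)| * ‖U x‖ ^ 2 ≤ (C₁ / R * ‖U x‖) * ‖U x‖ ^ 2 := by gcongr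
      _ = C₁ / R * ‖U x‖ ^ 3 := by ring
  have t5 : |∫ x, (P x - c) * ⟪U x, gradient φ x⟫| ≤ C₁ / R * JP := by
    refine abs_integral_le_of_support_subset hS (fun x hx => ?_) (fun x _ => ?_) hIP
    · rw [gradient_eq_zero_of_notMem_tsupport fun h => hx (hφS h), inner_zero_right, mul_zero]
    · rw [abs_mul]
      have hg : ‖gradient φ x‖ ≤ C₁ / R := by
        rw [gradient, LinearIsometryEquiv.norm_map]; exact hDφ x
      calc |P x - c| * |⟪U x, gradient φ x⟫| ≤ |P x - c| * (‖U x‖ * ‖gradient φ x‖) :=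
            mul_le_mul_of_nonneg_left (abs_real_inner_le_norm _ _) (abs_nonneg _)
        _ ≤ |P x - c| * (‖U x‖ * (C₁ / R)) := by gcongr
        _ = C₁ / R * (|P x - c| * ‖U x‖) := by ring
  -- left-hand side: `∫_{B(x₀,R)} |DU|² ≤ ∫ φ |DU|²`
  have hfrob : Continuous fun x => frobeniusNormSq (fderiv ℝ U x) :=
    continuous_frobeniusNormSq_fderiv hU2 two_ne_zero
  have hLHS : ∫ x in ball x₀ R, frobeniusNormSq (fderiv ℝ U x) ≤
      ∫ x, φ x * frobeniusNormSq (fderiv ℝ U x) := by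
    rw [← integral_indicator measurableSet_ball]
    refine integral_mono ?_ ?_ fun x => ?_
    · exact (hfrob.continuousOn.integrableOn_compact (isCompact_closedBall x₀ R)).mono_set
        ball_subset_closedBall |>.integrable_indicator measurableSet_ball
    · exact integrable_mul_of_hasCompactSupport_left hφ2.continuous hφc hfrob
    · by_cases hx : x ∈ ball x₀ R
      · have hx1 : φ x = 1 := hφ1 x (ball_subset_closedBall hx)
        rw [indicator_of_mem hx, hx1, one_mul]
      · rw [indicator_of_notMem hx]
        exact mul_nonneg (hφ01 x).1 (frobeniusNormSq_nonneg _)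
  -- assemble
  have hmain : ν * ∫ x, φ x * frobeniusNormSq (fderiv ℝ U x) ≤
      (ν * C₂ / (2 * R ^ 2) + a / 2 + a * C₁ * (‖x₀‖ + 2 * R) / (2 * R)) * J₂
        + C₁ / (2 * R) * J₃ + C₁ / R * JP := by
    rw [hid]
    have e1 := (le_abs_self _).trans t1
    have e2 := (le_abs_self _).trans t2
    have e3 := (le_abs_self _).trans t3
    have e4 := (le_abs_self _).trans t4
    have e5 := (le_abs_self _).trans t5
    have m1 := mul_le_mul_of_nonneg_left e1 (by positivity : 0 ≤ ν / 2)
    have m2 := mul_le_mul_of_nonneg_left e2 (by positivity : 0 ≤ a / 2)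
    have m3 := mul_le_mul_of_nonneg_left e3 (by positivity : 0 ≤ a / 2)
    have m4 := mul_le_mul_of_nonneg_left e4 (by positivity : (0 : ℝ) ≤ 1 / 2)
    have hsum := add_le_add (add_le_add (add_le_add (add_le_add m1 m2) m3) m4) e5
    refine hsum.trans (le_of_eq ?_)
    field_simp
  calc ν * ∫ x in ball x₀ R, frobeniusNormSq (fderiv ℝ U x)
      ≤ ν * ∫ x, φ x * frobeniusNormSq (fderiv ℝ U x) := mul_le_mul_of_nonneg_left hLHS hν
    _ ≤ _ := hmain

end GradientEstimate

end Literature.Analysis.FluidPDE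

end
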